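import Summits.HubbardSuperconductivity.HubbardSuperconductivity.Theorems.AnisotropyChordTransferFibre3Level2Toolkit
import Summits.HubbardSuperconductivity.HubbardSuperconductivity.Theorems.AnisotropyChordTransferFibre3Fourier

/-!
# Route `AnisotropyChord` / H0 rotor rung: PartN35 (Level-2 toolkit) — the exact 1D ROW identities `RingResolventSum`,
`RingResolventSumTrig` PROVED

PartN35 = `…Fibre3Level2Toolkit` (theory seat `hubbard-h0-rotor-theory-1`, memo 21 §310(a); port by `hubbard-h0-rotor-p2`).
The classical 1D lattice Green's function on a ring of `L` sites:

* **`ringResolventSum_holds : RingResolventSum L`** — for `μ > 0`,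
  `Σ_{n ∈ ℤ_L} cos(2πny/L)/(cosh μ − cos(2πn/L)) = L·cosh((L/2 − y)μ)/(sinh μ · sinh(Lμ/2))`;
* **`ringResolventSumTrig_holds : RingResolventSumTrig L`** — the trigonometric continuation
  `Σ_n cos(2πny/L)/(cos α − cos(2πn/L)) = −L·cos((L/2 − y)α)/(sin α · sin(Lα/2))` (off the resonances).

Proof (one abstract lemma `ring_resolvent_abstract` for both): a profile `H(j) = φ((L/2 − j)s)` with `φ` even and
`φ(A + s) + φ(A − s) = 2a·φ(A)` solves the periodic difference equation `2a·H(k+1) − H(k+2) − H(k) = c·[k+1 = 0]` with the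
single source `c = 2a·φ(Ls/2) − 2φ((L/2 − 1)s)` at the seam (`ring_profile_eq`; the only `ZMod.val` bookkeeping is
`val_add_one`); the 1D discrete Fourier transform turns it into `Ĥ(n)·2(a − cos θ_n) = c`, and Fourier inversion
(`sum_hat_phZ`) gives `Σ_n cos(θ_n y)/(a − cos θ_n) = 2L·H(y)/c`.  For `φ = cosh`: `c = 2 sinh μ sinh(Lμ/2)`; for `φ = cos`:
`c = −2 sin α sin(Lα/2)`.

Nothing here proves superconductivity in the Hubbard model; these are helper lemmas of ONE conditional reduction
(rung stmt-HubbardSuperconductivity-19089).  Prover seat `hubbard-h0-rotor-p3` g0; `--supports stmt-HubbardSuperconductivity-19089`.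
-/

set_option linter.dupNamespace false
set_option autoImplicit false

noncomputable section

open scoped BigOperators
open Complex

namespace Summit.HubbardSuperconductivity.HubbardSuperconductivity.Theorems.AnisotropyChord.Transfer.Fibre3

variable (L : ℕ) [NeZero L]

/-! ## 1D characters: real parts and inversion -/

omit [NeZero L] in
/-- `Re e(n) = cos(2π n/L)`. [folklore] -/
theorem phZ_re_eq_cos (n : ZMod L) : (phZ L n).re = Real.cos (2 * Real.pi * n.val / L) := by
  unfold phZ
  rw [show (2 * (Real.pi : ℂ) * Complex.I * (((n.val : ℕ) : ℂ) / (L : ℂ)))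
      = ((2 * Real.pi * n.val / L : ℝ) : ℂ) * Complex.I by push_cast; ring, Complex.exp_ofReal_mul_I_re]

/-- `Re e(n·y) = cos(2π n y/L)` (arguments read through `val`). [folklore] -/
theorem phZ_mul_re_eq_cos (n y : ZMod L) : (phZ L (n * y)).re = Real.cos (2 * Real.pi * n.val * y.val / L) := by
  unfold phZ
  rw [ZMod.val_mul, ← exp_natCast_mod L (n.val * y.val)]
  rw [show (2 * (Real.pi : ℂ) * Complex.I * ((((n.val * y.val : ℕ)) : ℂ) / (L : ℂ)))
      = ((2 * Real.pi * n.val * y.val / L : ℝ) : ℂ) * Complex.I by push_cast; ring, Complex.exp_ofReal_mul_I_re]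

/-- `e(n) + e(−n) = 2cos(2π n/L)`. [folklore] -/
theorem phZ_add_phZ_neg (n : ZMod L) :
    phZ L n + phZ L (-n) = ((2 * Real.cos (2 * Real.pi * n.val / L) : ℝ) : ℂ) := by
  rw [← conj_phZ, Complex.add_conj, phZ_re_eq_cos]

/-- **1D Fourier inversion:** `Σ_n (Σ_j H(j) e(−nj)) e(ny) = L·H(y)`. [folklore] -/
theorem sum_hat_phZ (H : ZMod L → ℝ) (y : ZMod L) :
    ∑ n : ZMod L, (∑ j : ZMod L, (H j : ℂ) * phZ L (-(n * j))) * phZ L (n * y) = (L : ℂ) * (H y : ℂ) := by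
  classical
  simp_rw [Finset.sum_mul]
  rw [Finset.sum_comm]
  have key : ∀ j : ZMod L, ∑ n : ZMod L, (H j : ℂ) * phZ L (-(n * j)) * phZ L (n * y)
      = if y = j then (L : ℂ) * (H j : ℂ) else 0 := by
    intro j
    have e : ∀ n : ZMod L, (H j : ℂ) * phZ L (-(n * j)) * phZ L (n * y) = (H j : ℂ) * phZ L (n * (y - j)) := by
      intro n; rw [mul_assoc, ← phZ_add]; congr 2; ring
    rw [Finset.sum_congr rfl fun n _ => e n, ← Finset.mul_sum, sum_phZ_mul]
    by_cases h : y = j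
    · rw [if_pos (sub_eq_zero.mpr h), if_pos h]; ring
    · rw [if_neg (fun h' => h (sub_eq_zero.mp h')), if_neg h]; ring
  rw [Finset.sum_congr rfl fun j _ => key j, Finset.sum_ite_eq]
  simp

/-! ## The abstract ring resolvent -/

/-- **ABSTRACT RING RESOLVENT:** if `2a·H(k+1) − H(k+2) − H(k) = c·[k+1 = 0]` on `ℤ_L`, `a − cos θ_n ≠ 0` for all `n` and
`c ≠ 0`, then `Σ_n cos(θ_n y)/(a − cos θ_n) = 2L·H(y)/c`. [folklore] -/
theorem ring_resolvent_abstract (a c : ℝ) (H : ZMod L → ℝ)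
    (hE : ∀ k : ZMod L, 2 * a * H (k + 1) - H (k + 2) - H k = if k + 1 = 0 then c else 0)
    (hD : ∀ n : ZMod L, a - Real.cos (2 * Real.pi * n.val / L) ≠ 0) (hc : c ≠ 0) (y : ZMod L) :
    ∑ n : ZMod L, Real.cos (2 * Real.pi * n.val * y.val / L) / (a - Real.cos (2 * Real.pi * n.val / L))
      = 2 * L * H y / c := by
  classical
  obtain ⟨Hh, hHh⟩ : ∃ Hh : ZMod L → ℂ, ∀ n : ZMod L, Hh n = ∑ j : ZMod L, (H j : ℂ) * phZ L (-(n * j)) :=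
    ⟨fun n => ∑ j : ZMod L, (H j : ℂ) * phZ L (-(n * j)), fun n => rfl⟩
  -- (1) the transformed difference equation: `Ĥ(n)·(2a − 2cos θ_n) = c`
  have step1 : ∀ n : ZMod L,
      Hh n * (((2 * (a - Real.cos (2 * Real.pi * n.val / L)) : ℝ)) : ℂ) = (c : ℂ) := by
    intro n
    have hsum : ∑ k : ZMod L, (((2 * a * H (k + 1) - H (k + 2) - H k : ℝ)) : ℂ) * phZ L (-(n * (k + 1)))
        = (c : ℂ) := by
      have hpt : ∀ k : ZMod L, (((2 * a * H (k + 1) - H (k + 2) - H k : ℝ)) : ℂ) * phZ L (-(n * (k + 1)))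
          = if k = -1 then (c : ℂ) * phZ L (-(n * (k + 1))) else 0 := by
        intro k
        rw [hE k]
        have hiff : (k + 1 = 0) ↔ (k = -1) := add_eq_zero_iff_eq_neg
        by_cases hk : k = -1
        · rw [if_pos (hiff.mpr hk), if_pos hk]
        · rw [if_neg (fun h => hk (hiff.mp h)), if_neg hk]; push_cast; ring
      rw [Finset.sum_congr rfl fun k _ => hpt k, Finset.sum_ite_eq']
      simp [phZ_zero]
    have S1 : ∑ k : ZMod L, ((H (k + 1) : ℝ) : ℂ) * phZ L (-(n * (k + 1))) = Hh n := by
      rw [hHh]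
      exact Fintype.sum_equiv (Equiv.addRight 1) _ _ (fun k => rfl)
    have S2 : ∑ k : ZMod L, ((H (k + 2) : ℝ) : ℂ) * phZ L (-(n * (k + 1))) = phZ L n * Hh n := by
      rw [hHh, Finset.mul_sum]
      refine Fintype.sum_equiv (Equiv.addRight 2) _ _ (fun k => ?_)
      simp only [Equiv.coe_addRight]
      rw [show -(n * (k + 1)) = n + -(n * (k + 2)) by ring, phZ_add]
      ring
    have S3 : ∑ k : ZMod L, ((H k : ℝ) : ℂ) * phZ L (-(n * (k + 1))) = phZ L (-n) * Hh n := by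
      rw [hHh, Finset.mul_sum]
      refine Finset.sum_congr rfl fun k _ => ?_
      rw [show -(n * (k + 1)) = -(n * k) + -n by ring, phZ_add]
      ring
    have hexp : ∑ k : ZMod L, (((2 * a * H (k + 1) - H (k + 2) - H k : ℝ)) : ℂ) * phZ L (-(n * (k + 1)))
        = (2 * a : ℂ) * (∑ k : ZMod L, ((H (k + 1) : ℝ) : ℂ) * phZ L (-(n * (k + 1))))
          - (∑ k : ZMod L, ((H (k + 2) : ℝ) : ℂ) * phZ L (-(n * (k + 1))))
          - (∑ k : ZMod L, ((H k : ℝ) : ℂ) * phZ L (-(n * (k + 1)))) := by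
      rw [Finset.mul_sum, ← Finset.sum_sub_distrib, ← Finset.sum_sub_distrib]
      refine Finset.sum_congr rfl fun k _ => ?_
      push_cast; ring
    rw [hexp, S1, S2, S3] at hsum
    rw [← hsum]
    have h2 : (((2 * (a - Real.cos (2 * Real.pi * n.val / L))) : ℝ) : ℂ) = 2 * (a : ℂ) - (phZ L n + phZ L (-n)) := by
      rw [phZ_add_phZ_neg]; push_cast; ring
    rw [h2]
    ring
  -- (2) `Ĥ(n) = c/(2(a − cos θ_n))`
  have step2 : ∀ n : ZMod L, Hh n = ((c / (2 * (a - Real.cos (2 * Real.pi * n.val / L))) : ℝ) : ℂ) := by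
    intro n
    have hDn : ((2 * (a - Real.cos (2 * Real.pi * n.val / L)) : ℝ) : ℂ) ≠ 0 := by
      exact_mod_cast mul_ne_zero two_ne_zero (hD n)
    rw [Complex.ofReal_div, eq_div_iff hDn]
    exact step1 n
  -- (3) inversion
  have step3 : ∑ n : ZMod L, Hh n * phZ L (n * y) = (L : ℂ) * (H y : ℂ) := by
    simp only [hHh]
    exact sum_hat_phZ L H y
  -- (4) combine: `Σ_n e(ny)/(a − cos θ_n) = 2L H(y)/c`
  have hcC : (c : ℂ) ≠ 0 := by exact_mod_cast hc
  have step4 : ∑ n : ZMod L, (((1 / (a - Real.cos (2 * Real.pi * n.val / L))) : ℝ) : ℂ) * phZ L (n * y)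
      = (((2 * L * H y / c) : ℝ) : ℂ) := by
    have e : ∀ n : ZMod L, (((1 / (a - Real.cos (2 * Real.pi * n.val / L))) : ℝ) : ℂ) * phZ L (n * y)
        = ((2 / c : ℝ) : ℂ) * (Hh n * phZ L (n * y)) := by
      intro n
      have hDn : ((a - Real.cos (2 * Real.pi * n.val / L) : ℝ) : ℂ) ≠ 0 := by exact_mod_cast hD n
      rw [step2 n]
      push_cast
      field_simp
    rw [Finset.sum_congr rfl fun n _ => e n, ← Finset.mul_sum, step3]
    push_cast
    field_simp
  -- (5) real parts
  have hre := congrArg Complex.re step4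
  rw [Complex.ofReal_re, Complex.re_sum] at hre
  simp only [Complex.re_ofReal_mul, phZ_mul_re_eq_cos] at hre
  rw [← hre]
  refine Finset.sum_congr rfl fun n _ => ?_
  rw [div_eq_mul_one_div, mul_comm]

/-! ## The profile `H(j) = φ((L/2 − j)s)` solves the difference equation with one source at the seam -/

omit [NeZero L] in
/-- successor bookkeeping on `ℤ_L`: either `val(k+1) = val k + 1` (and `k + 1 ≠ 0`), or `val k + 1 = L` and `k + 1 = 0`. [folklore] -/
theorem val_add_one [NeZero L] (k : ZMod L) :
    ((k + 1 : ZMod L).val = k.val + 1 ∧ k + 1 ≠ 0) ∨ (k.val + 1 = L ∧ k + 1 = 0) := by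
  have hlt := ZMod.val_lt k
  have hv : (k + 1 : ZMod L).val = (k.val + 1) % L := by
    rw [ZMod.val_add, ZMod.val_one_eq_one_mod, Nat.add_mod_mod]
  by_cases h : k.val + 1 < L
  · left
    rw [hv, Nat.mod_eq_of_lt h]
    refine ⟨rfl, fun h0 => ?_⟩
    have := (ZMod.val_eq_zero (k + 1)).mpr h0
    rw [hv, Nat.mod_eq_of_lt h] at this
    omega
  · right
    have heq : k.val + 1 = L := by omega
    refine ⟨heq, ?_⟩
    apply (ZMod.val_eq_zero (k + 1)).mp
    rw [hv, heq, Nat.mod_self]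

/-- `H(k+1) = φ((L/2 − (val k + 1))s)` for an even `φ` (the seam `val = L ↦ 0` is invisible by evenness). [folklore] -/
theorem profile_succ (φ : ℝ → ℝ) (s : ℝ) (heven : ∀ x, φ (-x) = φ x) (k : ZMod L) :
    φ (((L : ℝ) / 2 - (k + 1 : ZMod L).val) * s) = φ (((L : ℝ) / 2 - (k.val + 1)) * s) := by
  rcases val_add_one L k with ⟨hv, -⟩ | ⟨hv, h0⟩
  · rw [hv]; push_cast; ring_nf
  · rw [h0, ZMod.val_zero]
    have hcast : ((k.val : ℝ) + 1) = L := by exact_mod_cast hv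
    rw [hcast, show ((L : ℝ) / 2 - L) * s = -(((L : ℝ) / 2 - ((0 : ℕ) : ℝ)) * s) by push_cast; ring, heven]

/-- **the difference equation of the profile:** for `φ` even with `φ(A + s) + φ(A − s) = 2a·φ(A)`,
`2a·H(k+1) − H(k+2) − H(k) = (2a·φ(Ls/2) − 2φ((L/2 − 1)s))·[k + 1 = 0]`, `H(j) = φ((L/2 − j)s)`. [folklore] -/
theorem ring_profile_eq (φ : ℝ → ℝ) (s a : ℝ) (heven : ∀ x, φ (-x) = φ x)
    (hadd : ∀ A : ℝ, φ (A + s) + φ (A - s) = 2 * a * φ A) (k : ZMod L) :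
    2 * a * φ (((L : ℝ) / 2 - (k + 1 : ZMod L).val) * s) - φ (((L : ℝ) / 2 - (k + 2 : ZMod L).val) * s)
        - φ (((L : ℝ) / 2 - k.val) * s)
      = if k + 1 = 0 then 2 * a * φ ((L : ℝ) / 2 * s) - 2 * φ (((L : ℝ) / 2 - 1) * s) else 0 := by
  have h2 : φ (((L : ℝ) / 2 - (k + 2 : ZMod L).val) * s) = φ (((L : ℝ) / 2 - ((k + 1 : ZMod L).val + 1)) * s) := by
    rw [show k + 2 = (k + 1) + 1 by ring]; exact profile_succ L φ s heven (k + 1)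
  rw [h2]
  rcases val_add_one L k with ⟨hv, hne⟩ | ⟨hv, h0⟩
  · -- interior point: the three-term recursion
    rw [if_neg hne, hv]
    push_cast
    have := hadd (((L : ℝ) / 2 - (k.val + 1)) * s)
    rw [show ((L : ℝ) / 2 - (k.val + 1)) * s + s = ((L : ℝ) / 2 - k.val) * s by ring,
      show ((L : ℝ) / 2 - (k.val + 1)) * s - s = ((L : ℝ) / 2 - ((k.val : ℝ) + 1 + 1)) * s by ring] at this
    linarith
  · -- the seam `k + 1 = 0`
    rw [if_pos h0, h0, ZMod.val_zero]
    have hcast : (k.val : ℝ) = L - 1 := by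
      have : ((k.val : ℝ) + 1) = L := by exact_mod_cast hv
      linarith
    rw [hcast]
    push_cast
    rw [show ((L : ℝ) / 2 - (L - 1)) * s = -(((L : ℝ) / 2 - 1) * s) by ring, heven]
    ring

/-! ## `RingResolventSum` (hyperbolic) -/

/-- ★ **`RingResolventSum L` holds.** [folklore] -/
theorem ringResolventSum_holds : RingResolventSum L := by
  intro μ hμ y
  have hL : (0 : ℝ) < L := by exact_mod_cast Nat.pos_of_ne_zero (NeZero.ne L)
  -- the profile and its difference equation
  have hadd : ∀ A : ℝ, Real.cosh (A + μ) + Real.cosh (A - μ) = 2 * Real.cosh μ * Real.cosh A := by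
    intro A; rw [Real.cosh_add, Real.cosh_sub]; ring
  have hE := ring_profile_eq L Real.cosh μ (Real.cosh μ) Real.cosh_neg hadd
  -- the source `c = 2 sinh μ sinh(Lμ/2)`
  have hc : 2 * Real.cosh μ * Real.cosh ((L : ℝ) / 2 * μ) - 2 * Real.cosh (((L : ℝ) / 2 - 1) * μ)
      = 2 * Real.sinh μ * Real.sinh (L * μ / 2) := by
    rw [show ((L : ℝ) / 2 - 1) * μ = L * μ / 2 - μ by ring, Real.cosh_sub, show (L : ℝ) / 2 * μ = L * μ / 2 by ring]
    ring
  have hsinh1 : 0 < Real.sinh μ := Real.sinh_pos_iff.mpr hμ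
  have hsinh2 : 0 < Real.sinh (L * μ / 2) := Real.sinh_pos_iff.mpr (by positivity)
  have hc0 : 2 * Real.sinh μ * Real.sinh (L * μ / 2) ≠ 0 := by positivity
  have hD : ∀ n : ZMod L, Real.cosh μ - Real.cos (2 * Real.pi * n.val / L) ≠ 0 := by
    intro n
    have h1 := Real.one_lt_cosh.mpr hμ.ne'
    have h2 := Real.cos_le_one (2 * Real.pi * n.val / L)
    linarith
  have key := ring_resolvent_abstract L (Real.cosh μ) (2 * Real.sinh μ * Real.sinh (L * μ / 2))
    (fun j => Real.cosh (((L : ℝ) / 2 - j.val) * μ)) (fun k => by rw [hE k, hc]) hD hc0 y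
  rw [key]
  field_simp

/-! ## `RingResolventSumTrig` -/

/-- ★ **`RingResolventSumTrig L` holds.** [folklore] -/
theorem ringResolventSumTrig_holds : RingResolventSumTrig L := by
  intro α hsin hsinL hres y
  have hadd : ∀ A : ℝ, Real.cos (A + α) + Real.cos (A - α) = 2 * Real.cos α * Real.cos A := by
    intro A; rw [Real.cos_add, Real.cos_sub]; ring
  have hE := ring_profile_eq L Real.cos α (Real.cos α) Real.cos_neg hadd
  have hc : 2 * Real.cos α * Real.cos ((L : ℝ) / 2 * α) - 2 * Real.cos (((L : ℝ) / 2 - 1) * α)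
      = -(2 * Real.sin α * Real.sin (L * α / 2)) := by
    rw [show ((L : ℝ) / 2 - 1) * α = L * α / 2 - α by ring, Real.cos_sub, show (L : ℝ) / 2 * α = L * α / 2 by ring]
    ring
  have hc0 : -(2 * Real.sin α * Real.sin (L * α / 2)) ≠ 0 := by
    rw [neg_ne_zero]; exact mul_ne_zero (mul_ne_zero two_ne_zero hsin) hsinL
  have hD : ∀ n : ZMod L, Real.cos α - Real.cos (2 * Real.pi * n.val / L) ≠ 0 :=
    fun n => sub_ne_zero.mpr (hres n)
  have key := ring_resolvent_abstract L (Real.cos α) (-(2 * Real.sin α * Real.sin (L * α / 2)))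
    (fun j => Real.cos (((L : ℝ) / 2 - j.val) * α)) (fun k => by rw [hE k, hc]) hD hc0 y
  rw [key]
  field_simp

end Summit.HubbardSuperconductivity.HubbardSuperconductivity.Theorems.AnisotropyChord.Transfer.Fibre3

end
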